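import Summits.QuantumFields.QCD.Theses.PauliWegnerSea
import Literature.MathematicalPhysics.QuantumFieldTheory.QCDHeavyQuarkPropagator

/-!
# Stub `stub_heavyDecay` of line `threshold-tuned-witness`
(crux `Summit.QuantumFields.QCD.Theses.PauliWegnerSea.OneScaleTrajectory`, item stmt-QuantumFields-11513)

Heavy-mass decay of the phase-quenched fractional moment AT LATTICE RATE, in tree vocabulary only:
for bare masses `m_f ≥ m₀ > 0`, every coupling `β`, every torus of side `2S+1`, every flavour `f`
and every `v ∈ box S`,
`E_{|w|,β,S}[(Σ_{a,i,b,j} |G_f(0,v)|)^{1/2}] ≤ (144/m₀)^{1/2} · exp(-½ log((m₀+4)/4) · ‖v‖_∞)`.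

Proof: configuration-wise, the tree's hopping bound `norm_inv_diracMatrix_apply_le_of_le` gives
every entry `≤ m₀⁻¹ θ₀^n` with `θ₀ = 4/(m₀+4) < 1` and `n = |v_{i₀}| ≥ ‖v‖_∞` the cyclic distance of
a maximal coordinate, so the 144-term colour–spin sum is `≤ 144 m₀⁻¹ θ₀^n` and its square root is
`≤ (144/m₀)^{1/2} exp(-(½ log θ₀⁻¹) ‖v‖_∞)`; this bound is integrated against the positive weight
`|det D(U)|` (never zero for positive masses, so the denominator is positive).  This is the proof of
the tree's `phaseQuenched_fractionalMoment_decay_of_heavy` with the lattice rate `½ log((m₀+4)/4)`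
kept instead of being weakened to `a_k`.
-/

noncomputable section

namespace Summit.QuantumFields.QCD.Cruxes.OneScaleTrajectory.ThresholdTunedWitness

open scoped BigOperators Topology
open MeasureTheory Filter Set
open Literature.MathematicalPhysics.QuantumFieldTheory Literature.MathematicalPhysics.QuantumLattice
  Literature.Probability.LatticeModels

/-- Registered stub `stub_heavyDecay` of line `threshold-tuned-witness` for crux
stmt-QuantumFields-11513 — **heavy-mass decay of the phase-quenched fractional moment at lattice
rate**: for bare masses `m_f ≥ m₀ > 0`, every coupling `β`, every torus `2S+1`, flavour `f` and
`v ∈ box S`, the `|det|`-reweighted Wilson average of `(Σ_{a,i,b,j} |G_f((0,a,i),(v,b,j))|)^{1/2}`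
is `≤ (144/m₀)^{1/2} · exp(-½ log((m₀+4)/4) · ‖v‖_∞)` (hopping-parameter-expansion regime,
Montvay–Münster §5.1.2; adapted from the tree's `phaseQuenched_fractionalMoment_decay_of_heavy`). -/
theorem stub_heavyDecay :
    ∀ (Nf : ℕ) (m₀ : ℝ), 0 < m₀ → ∀ (β : ℝ) (mq : Fin Nf → ℝ), (∀ f, m₀ ≤ mq f) →
      ∀ (S : ℕ) (f : Fin Nf) (v : Literature.Probability.LatticeModels.Site 4), v ∈ box 4 S →
        (∫ U : GaugeConfig 4 (2 * S + 1) (Matrix.specialUnitaryGroup (Fin 3) ℂ),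
            ‖(diracMatrix U mq).det‖ *
              (∑ a : Fin 3, ∑ i : Fin 4, ∑ b : Fin 3, ∑ j : Fin 4,
                ‖(diracMatrix U mq)⁻¹ (quarkEquiv (f, (Torus.proj (2 * S + 1) 0, a, i)))
                  (quarkEquiv (f, (Torus.proj (2 * S + 1) v, b, j)))‖) ^ (1 / 2 : ℝ)
            ∂(wilsonMeasure (fundamentalRep (Fin 3)) β)) /
          (∫ U : GaugeConfig 4 (2 * S + 1) (Matrix.specialUnitaryGroup (Fin 3) ℂ),
            ‖(diracMatrix U mq).det‖ ∂(wilsonMeasure (fundamentalRep (Fin 3)) β)) ≤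
        (144 / m₀) ^ (1 / 2 : ℝ) * Real.exp (-(Real.log ((m₀ + 4) / 4) / 2 * ‖v‖)) := by
  -- adapted from `Literature.MathematicalPhysics.QuantumFieldTheory.phaseQuenched_fractionalMoment_decay_of_heavy`
  intro Nf m₀ hm₀ β mq hM S f v hv
  set θ₀ : ℝ := 4 / (m₀ + 4) with hθ₀
  have hθ₀pos : 0 < θ₀ := by positivity
  have hθ₀lt : θ₀ < 1 := by rw [hθ₀, div_lt_one (by linarith)]; linarith
  have hL : Real.log θ₀ < 0 := Real.log_neg hθ₀pos hθ₀lt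
  have hlog : Real.log ((m₀ + 4) / 4) = -Real.log θ₀ := by
    rw [← Real.log_inv, hθ₀, inv_div]
  set Cst : ℝ := (144 / m₀) ^ (1 / 2 : ℝ) with hCst
  obtain ⟨i₀, -, hmax⟩ :=
    Finset.exists_max_image Finset.univ (fun i : Fin 4 => ‖v i‖) Finset.univ_nonempty
  have hvi : |v i₀| ≤ (S : ℤ) := by
    have := Fintype.mem_piFinset.1 hv i₀
    rw [Finset.mem_Icc] at this
    exact abs_le.2 ⟨by linarith [this.1], this.2⟩
  set n : ℕ := (v i₀).natAbs with hn
  have hnorm : ‖v‖ ≤ (n : ℝ) := by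
    have h1 : ‖v‖ ≤ ‖v i₀‖ :=
      (pi_norm_le_iff_of_nonneg (norm_nonneg _)).2 fun i => hmax i (Finset.mem_univ i)
    rw [Int.norm_eq_abs] at h1
    rw [hn, Nat.cast_natAbs, Int.cast_abs]
    exact h1
  set K : ℝ := m₀⁻¹ * θ₀ ^ n with hK
  have hK0 : 0 ≤ K := by positivity
  have hcd : ((Torus.proj (2 * S + 1) (0 : Literature.Probability.LatticeModels.Site 4)) i₀ -
      (Torus.proj (2 * S + 1) v) i₀).valMinAbs.natAbs = n := by
    simp only [Torus.proj, Pi.zero_apply, Int.cast_zero, zero_sub]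
    exact natAbs_valMinAbs_neg_intCast (v i₀) (by exact_mod_cast hvi)
  have hentry : ∀ (U : GaugeConfig 4 (2 * S + 1) SU3) (a' : Fin 3) (i : Fin 4) (b : Fin 3)
      (j : Fin 4),
      ‖(diracMatrix U mq)⁻¹ (quarkEquiv (f, (Torus.proj (2 * S + 1) 0, a', i)))
        (quarkEquiv (f, (Torus.proj (2 * S + 1) v, b, j)))‖ ≤ K := by
    intro U a' i b j
    have h := norm_inv_diracMatrix_apply_le_of_le U mq hm₀ hM f (Torus.proj (2 * S + 1) 0, a', i)
      (Torus.proj (2 * S + 1) v, b, j) i₀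
    rwa [hcd] at h
  have hsum : ∀ U : GaugeConfig 4 (2 * S + 1) SU3,
      (∑ a' : Fin 3, ∑ i : Fin 4, ∑ b : Fin 3, ∑ j : Fin 4,
        ‖(diracMatrix U mq)⁻¹ (quarkEquiv (f, (Torus.proj (2 * S + 1) 0, a', i)))
          (quarkEquiv (f, (Torus.proj (2 * S + 1) v, b, j)))‖) ≤ 144 * K := by
    intro U
    calc _ ≤ ∑ _a' : Fin 3, ∑ _i : Fin 4, ∑ _b : Fin 3, ∑ _j : Fin 4, K :=
          Finset.sum_le_sum fun a' _ => Finset.sum_le_sum fun i _ => Finset.sum_le_sum fun b _ =>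
            Finset.sum_le_sum fun j _ => hentry U a' i b j
      _ = 144 * K := by simp; ring
  set B₀ : ℝ := Cst * Real.exp (-(Real.log ((m₀ + 4) / 4) / 2 * ‖v‖)) with hB₀
  have hB : (144 * K) ^ (1 / 2 : ℝ) ≤ B₀ := by
    have h1 : (144 * K) = (144 / m₀) * θ₀ ^ n := by rw [hK, div_eq_mul_inv]; ring
    rw [h1, Real.mul_rpow (by positivity) (by positivity), hB₀, hCst, hlog]
    gcongr
    have h2 : θ₀ ^ n = Real.exp ((n : ℝ) * Real.log θ₀) := by
      rw [Real.exp_nat_mul, Real.exp_log hθ₀pos]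
    rw [h2, ← Real.exp_mul]
    apply Real.exp_le_exp.2
    have h3 : Real.log θ₀ * (n : ℝ) ≤ Real.log θ₀ * ‖v‖ := mul_le_mul_of_nonpos_left hnorm hL.le
    linarith
  have hX : ∀ U : GaugeConfig 4 (2 * S + 1) SU3,
      (∑ a' : Fin 3, ∑ i : Fin 4, ∑ b : Fin 3, ∑ j : Fin 4,
        ‖(diracMatrix U mq)⁻¹ (quarkEquiv (f, (Torus.proj (2 * S + 1) 0, a', i)))
          (quarkEquiv (f, (Torus.proj (2 * S + 1) v, b, j)))‖) ^ (1 / 2 : ℝ) ≤ B₀ := fun U =>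
    (Real.rpow_le_rpow (by positivity) (hsum U) (by norm_num)).trans hB
  have hdet : ∀ U : GaugeConfig 4 (2 * S + 1) SU3, (diracMatrix U mq).det ≠ 0 := fun U =>
    det_diracMatrix_ne_zero_of_pos U mq fun g => hm₀.trans_le (hM g)
  have hZ : 0 < ∫ U : GaugeConfig 4 (2 * S + 1) SU3, ‖(diracMatrix U mq).det‖
      ∂(wilsonMeasure (fundamentalRep (Fin 3)) β) :=
    integral_norm_det_diracMatrix_pos_of_exists β mq ⟨fun _ => 1, hdet _⟩
  have hnum : (∫ U : GaugeConfig 4 (2 * S + 1) SU3, ‖(diracMatrix U mq).det‖ *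
      (∑ a' : Fin 3, ∑ i : Fin 4, ∑ b : Fin 3, ∑ j : Fin 4,
        ‖(diracMatrix U mq)⁻¹ (quarkEquiv (f, (Torus.proj (2 * S + 1) 0, a', i)))
          (quarkEquiv (f, (Torus.proj (2 * S + 1) v, b, j)))‖) ^ (1 / 2 : ℝ)
      ∂(wilsonMeasure (fundamentalRep (Fin 3)) β)) ≤
      (∫ U : GaugeConfig 4 (2 * S + 1) SU3, ‖(diracMatrix U mq).det‖
        ∂(wilsonMeasure (fundamentalRep (Fin 3)) β)) * B₀ := by
    rw [← integral_mul_const]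
    refine integral_mono_of_nonneg (Eventually.of_forall fun U => ?_)
      ((integrable_norm_det_diracMatrix mq _).mul_const B₀) (Eventually.of_forall fun U => ?_)
    · exact mul_nonneg (norm_nonneg _) (Real.rpow_nonneg (by positivity) _)
    · exact mul_le_mul_of_nonneg_left (hX U) (norm_nonneg _)
  rw [div_le_iff₀ hZ]
  exact hnum.trans_eq (mul_comm _ _)

end Summit.QuantumFields.QCD.Cruxes.OneScaleTrajectory.ThresholdTunedWitness

end
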